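import Summits.Ventures.CertifiedManyBodySolver.Theses.TcThermcert1
import Summits.Ventures.CertifiedManyBodySolver.Observables.StiffnessThermalOddMomentHook
import Literature.MathematicalPhysics.QuantumLattice.HubbardTTPrimeCanonicalStatesChargedRows
import Literature.MathematicalPhysics.QuantumLattice.HubbardTTPrimeChemicalPotentialBand
import Literature.MathematicalPhysics.QuantumLattice.InfVolFermionStateTorusLimitBogoliubovRow
import Literature.MathematicalPhysics.QuantumLattice.FermionTorusTranslationSums
import HarnessLib
import Summits.Ventures.CertifiedManyBodySolver.Theorems.TcThermcert1Defs
import Summits.Ventures.CertifiedManyBodySolver.Observables.StiffnessThermalTrialGeneratorHook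

/-!
# Line `trialgen_b10` for crux K1 `ThermalStiffnessCeilingU8b10_le_1o8` of route «hubbard-tc-thermcert-1» (`TcThermcert1`)
# — a certified LOCAL TRIAL-GENERATOR (polarisation-class, Bogoliubov–Duhamel) current word at β·t = 10

Cell `pub/hubbard-tc` (MO-S3), D-0154 (1) block (D); CRUX-PLAN by hub-tc-therm-plan-1 g1 (2026-08-28); v2 after the refuter audit
FINDING #2 of hub-tc-therm-crit-2 g1 (`Stub2Uniform.lean` 6a21b4749dbe9595, co-signed hub-tc-therm-crit-1 g0): the former STUB 2 (row
admissibility) is PROVED here in its μ₀-UNIFORM form (their proof, generalised to every `(β; 1, t′, U; n)`), and the certificate stub is the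
WEAKER per-μ₀ form on the SUPPORTING chemical potentials of the band (their STUB 3″ ∧ band).
HONEST FRAMING: a one-sided CEILING chain on the thermal flux stiffness under hypotheses; nothing about the Hubbard model's physics is
proved in this file (the two `stub_*` theorems are `sorry`); KT ceilings never assert superconductivity; NO lower bound on
`T_c` is claimed.

THE CRUX (fixed, route decl): `ObsThermalStiffnessSeqCeilingAtBeta 0 8 (7/8) 10 (1/8)` — at `β·t = 10`, `(U, n, t′) = (8, 7/8, 0)`,
every thermal uniform flux-stiffness constant of the canonical `(rectN (7/8) L, S^z = 0)` sectors along any `L_j → ∞` is `≤ 1/8`.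

THE LINE. The tree's Krylov-3 hook (`ObsThermalStiffnessSeqCeilingAtBeta_of_torusLimit_oddMoment_le`) reads the leaf off ONE
linear word `½ω(k₀) + λω(d₁) − (λ²/2)ω(m₃′)` in the torus-limit states; hubbard-tc-mod-2 measured that this single trial operator
(`C = i[H, J]`) cannot reach `1/8` even in the exact state on 12-site clusters (`c_K3 = 0.17–0.25 > 0.1273`). The finite-volume
engine behind it, `thermalStiffnessTT'_le_kin_sub_trialOperator` (pub-hubbard), holds for EVERY Hermitian trial operator `C` on
the sector space. This line replaces the Krylov vector by the translation sum `C_a = Σ_v T_v Γa` of an ARBITRARY gauge-invariant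
even Hermitian local generator `a ∈ 𝔄_{[-r,r]²}` (a finite rational combination of local words — the span the certificate
searches), whose three words are again LOCAL (`FermionTorusTranslationSums`: commutators of translation sums are translation
sums of a local density):

  `W_a = ½Γk₀ + i·Γd_a + ½m_a ∈ 𝔄_{[-(3r+2), 3r+2]²}`,  `d_a = Σ_z [τ_z j₀, a]` (density of `[𝒥, C_a]`),
  `m_a = Σ_z [τ_z a, h_a]`, `h_a = H_{[-(r+1),r+1]²}Γa − Γa H_{[-(r+1),r+1]²}` (density of `[C_a, [H, C_a]]`).

* STUB 1 `stub_trialGeneratorHook` (L): the GENERAL LOCAL-TRIAL-GENERATOR THERMAL HOOK — if every torus limit `ω` of the canonical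
  sector Gibbs states at `β` has `Re ω(W_a) ≤ q`, then `ObsThermalStiffnessSeqCeilingAtBeta t′ U n β q` (finite volume:
  `thermalStiffnessTT'_le_kin_sub_trialOperator` at `μ = 1` with `C = (C_a)`-block, `−‖z‖ ≤ Re(i·z′)`, the two locality identities
  `⟨ψ,[𝒜,𝒞]ψ⟩ = L²·torusAvg(commDensity)` and `[H_L, Σ_v T_v Γa] = Σ_v T_v Γ h_a`; limit: `eventually_re_sectorGibbsAvg_le_of_forall_torusLimit`).
  The Krylov-3 case of exactly this statement is the tree's hook; this is its one-parameter-family → all-local-generators generalisation.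
* PROVED (§1′, was STUB 2; proof = crit-2's `Stub2Uniform.lean`, generalised): at EVERY supporting chemical potential `μ₀` of the canonical
  pressure `p(β; 1, t′, U; ·)` at `n` (`IsSupportingMu`, the contact equation of `exists_chemicalPotential_mem_band`; a thermodynamic condition
  that never mentions `ω`), EVERY torus limit `ω` is a THERMAL ROW STATE (`isThermalRowState_of_supportingMu`: translation invariant, density `n`,
  stationarity + energy–entropy-balance rows for every local generator w.r.t. `K_{Λ′} = gcLocalHamiltonianTT' Λ′ 1 t′ U μ₀ 0` via the tree's
  `…_of_localDKMS` theorems + `localDKMSOfVariationalPrincipleTTPrime_holds`, canonical Bogoliubov rows via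
  `…re_expect_bog_nonneg_of_sectorGibbs_of_thicken_subset`), and a supporting `μ₀` exists IN THE BAND (`exists_supportingMu_mem_band`).
* STUB 2 `stub_trialGeneratorCertificate_b10` (XL — THE CRUX CONTENT): for EVERY banded supporting `μ₀`, SOME local generator `a` (chosen per
  `μ₀`) has `Re ω(W_a) ≤ 1/8` for every thermal row state `ω` at `β = 10`, `(t′, U, n) = (0, 8, 7/8)`, `μ₀` — the kernel form of a certified
  T > 0 current–current relaxation (dual certificate `1/8 − W_a = Σ rows·multipliers + SOS` in the window algebra; rows AFFINE in `μ₀`, so an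
  interval of `μ₀` costs its two endpoints for frozen dual data), the instrument D-0154 (1) block (D) asks hubbard-thermal to build. CHARGE CLASS
  (crit-1 rider): `a` and the Bogoliubov rows are `N`-neutral (`μ₀` drops out of them identically); `μ₀` enters ONLY through charged
  generators `A` in the energy–entropy-balance rows — a certificate using neutral rows only is μ₀-free.
* `ThermalStiffnessCeilingU8b10_le_1o8_of` : STUB 1 → STUB 2 → the crux (sorry-free composition through the proved §1′).

Barrier bookkeeping (KT-THERMAL-INTERFACE v2.20c; Literature.Barriers.HubbardSuperconductivity.*): the polarisation class never sees
the energy-diagonal (Drude-type) part of the current Duhamel function, so the IDEAL reach of STUB 3 over all `a` is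
`½κ_x − Λ_reg(β)` (the thermal Drude-type weight), not zero; `EnergyWindowCeilingResolution` / θ* = 0.2011 is evaded because `W_a` is
not an energy word; `StiffnessFloorInvisibleToSpectralMoments` does not bite (ceilings only).

References: DLS1978 §2 eqs. (22′), (27), (28); BratteliRobinsonII1997 Thm. 6.2.4, §5.2.2; FawziFawziScalet2024 Thm. 3.1;
ArakiMoriya2003 Thm. 12.11; ScalapinoWhiteZhang1993 §II; HazraVermaRanderia2019 eqs. (2)–(4); Lipparini2008 eq. (8.30).
-/

noncomputable section

namespace Summit.Ventures.CertifiedManyBodySolver.Cruxes.ThermalStiffnessCeilingU8b10_le_1o8.TrialGenB10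

open Filter Topology Matrix Finset
open Literature.MathematicalPhysics.QuantumLattice
open Literature.MathematicalPhysics.QuantumLattice.ThermodynamicLimit
open Literature.MathematicalPhysics.QuantumFieldTheory
open Literature.MathematicalPhysics.StatisticalMechanics
open Literature.Probability.LatticeModels
open Summit.Ventures.CertifiedManyBodySolver.Observables
open Summit.Ventures.CertifiedManyBodySolver.Theorems.TcThermcert1
open scoped ComplexConjugate ComplexOrder

/-! ## §0–§1 The objects and the two stub statements: IMPORTED from `Theorems/TcThermcert1Defs.lean` (hubbard-thermal-p4 D1, p614173; lead R133 (2)) —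
`curCommDensity hamCommLocal doubleCommDensity trialWord IsTrialGenerator InMuBand IsThermalRowState TrialGeneratorHook IsSupportingMu TrialGeneratorCertificateB10`
`TrialGeneratorCertificateAt trialGeneratorCertificateB10_iff` (VERBATIM the v2b/v3 local copies, namespace `…Theorems.TcThermcert1`, opened below). -/

/-! ## §1′ Proved: row admissibility, μ₀-uniform (hub-tc-therm-crit-2 g1, `Stub2Uniform.lean` 6a21b4749dbe9595, generalised) -/

/-- Rows at ANY supporting chemical potential, for EVERY torus limit, at every `(β; 1, t′, U; n)` with `0 ≤ U`, `0 < β`, `0 < n < 2`. -/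
theorem isThermalRowState_of_supportingMu {tp U n β μ₀ : ℝ} (hU : 0 ≤ U) (hβ : 0 < β) (hn0 : 0 < n) (hn2 : n < 2)
    (hμ₀ : IsSupportingMu β 1 tp U n μ₀) {ω : InfVolFermionState 2} {Ls : ℕ → ℕ} (hLs : Tendsto Ls atTop atTop)
    (hω : ω.IsTorusLimitOfMixture (sectorGibbsCount n) (fun L => sectorGibbsWeightTT' β 1 tp U n L)
      (fun L => sectorGibbsVectorTT' 1 tp U n L) Ls) :
    IsThermalRowState β tp U n μ₀ ω := by
  have hμ₀' : pressureTT' β 1 tp U n = gcPressureTT' β 1 tp U μ₀ - β * μ₀ * n := by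
    unfold IsSupportingMu at hμ₀; linarith
  refine ⟨hω.isTranslationInvariant, hω.density_eq_of_sectorGibbs 1 tp U hn0.le hn2.le β hLs,
    fun Λ Λ' hΛ h8 A => ⟨?_, fun s q hq => ?_⟩, fun Λ Λ' hΛ h8 A C hAN hAS hCN hCS => ?_⟩
  · exact hω.expect_commutator_gcLocalHamiltonianTT'_eq_zero_of_sectorGibbs_of_localDKMS 1 tp hU hβ
      localDKMSOfVariationalPrincipleTTPrime_holds hn0 hn2 hLs hμ₀' hΛ h8 A
  · exact hω.re_expect_eeb_nonneg_of_sectorGibbs_of_localDKMS 1 tp hU hβ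
      localDKMSOfVariationalPrincipleTTPrime_holds hn0 hn2 hLs hμ₀' hΛ h8 A hq
  · exact hω.re_expect_bog_nonneg_of_sectorGibbs_of_thicken_subset 1 tp U hβ.le hLs hΛ h8 hAN hAS hCN hCS

/-- A supporting chemical potential exists in the lattice-gas band (`exists_chemicalPotential_mem_band`). -/
theorem exists_supportingMu_mem_band {tp U n β : ℝ} (hU : 0 ≤ U) (hβ : 0 < β) (hn0 : 0 < n) (hn2 : n < 2) :
    ∃ μ₀ : ℝ, InMuBand β 1 tp U n μ₀ ∧ IsSupportingMu β 1 tp U n μ₀ := by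
  obtain ⟨⟨μ₀, hμ₀⟩, hband⟩ := exists_chemicalPotential_mem_band hβ.le 1 tp hU hβ hn0 hn2
  exact ⟨μ₀, hband μ₀ hμ₀, hμ₀⟩

/-! ## §2 Registered stubs (the only `sorry`s of this file) -/

/-- STUB 1 (L): **general local-trial-generator thermal hook** — the all-generators form of the tree's Krylov-3 hook
`ObsThermalStiffnessSeqCeilingAtBeta_of_torusLimit_oddMoment_le`. Why plausibly true: finite volume is
`thermalStiffnessTT'_le_kin_sub_trialOperator` (every Hermitian `C`, here the sector block of `Σ_v T_v Γa`, `μ = 1`) plus the two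
locality identities of `FermionTorusTranslationSums` / `hubbardTorusTT'_commutator_sum_relabel_translate`; the limit passage is
`eventually_re_sectorGibbsAvg_le_of_forall_torusLimit`. Why it might fail as typed: only by a bookkeeping slip (window sizes, the sign/phase
convention `−‖z‖ ≤ Re(i z′)`, the sector-block of a translation sum) — then re-type, the mathematics is the tree's.
[cite: DLS1978, §2 eqs. (22′), (27), (28)] -/
theorem stub_trialGeneratorHook : TrialGeneratorHook := by
  -- STUB 1 DISCHARGED (hubbard-thermal-p4 g0′ hook part 2 `StiffnessThermalTrialGeneratorHook.lean` p611646; swap verified in their K1StubCheck.lean 4dc576e4feb3eec5)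
  intro tp U n β hβ hn0 hn2 r a ha q hb
  exact ObsThermalStiffnessSeqCeilingAtBeta_of_torusLimit_trialGeneratorWord_le hβ hn0 hn2 r a ha.1 ha.2.1 ha.2.2.1 ha.2.2.2 hb

/-- STUB 2 (XL — THE CRUX CONTENT): **per banded supporting `μ₀`, a certified local trial-generator current word ≤ 1/8 at β·t = 10, (8, 7/8, 0).**
Why plausibly true: `W_a` ranges over the whole polarisation class, whose ideal reach is the thermal Drude-type weight
`½κ_x − Λ_reg(β = 10)` (< `½κ_x = 0.256`); prints place the regular part of the optical weight of the doped Hubbard model at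
`U/t = 8–10`, `x = 1/8` well above one half of the f-sum weight (float context only).
Why it might fail: (i) the model's Drude-type weight at `T = t/10` may itself exceed `0.127` (required certified share of the true
paramagnetic term `f_req = 0.50–0.69`, hub-tc-therm-idea-3); (ii) the relaxation's grip on the words at `β·t = 10` (measured capture today
0–0.9 % of the paramagnetic response) may stay far below what any affordable window `r` needs; (iii) if CHARGED energy–entropy rows are
load-bearing, the certificate must be μ₀-piecewise over the 16·t band (interval certificates; cost × #pieces) until a certified μ-enclosure lands.
[cite: ScalapinoWhiteZhang1993, §II] [cite: HazraVermaRanderia2019, eqs. (2)–(4)] -/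
theorem stub_trialGeneratorCertificate_b10 : TrialGeneratorCertificateB10 := by
  sorry

/-! ## §3 Composition (sorry-free) -/

/-- Hypothesis form: hook + certificate ⇒ the crux statement (unfolded), through the proved row admissibility of §1′. -/
theorem leaf_of_stubs (h₁ : TrialGeneratorHook) (h₂ : TrialGeneratorCertificateB10) :
    ObsThermalStiffnessSeqCeilingAtBeta 0 8 (7 / 8) 10 (1 / 8) := by
  obtain ⟨μ₀, hband, hsupp⟩ :=
    exists_supportingMu_mem_band (tp := 0) (U := 8) (n := 7 / 8) (β := 10) (by norm_num) (by norm_num) (by norm_num) (by norm_num)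
  obtain ⟨r, a, ha, hcert⟩ := h₂ μ₀ hband hsupp
  refine h₁ (tp := 0) (U := 8) (n := 7 / 8) (β := 10) (by norm_num) (by norm_num) (by norm_num) r a ha ?_
  intro ω Ls hLs hω
  exact hcert ω (isThermalRowState_of_supportingMu (by norm_num) (by norm_num) (by norm_num) (by norm_num) hsupp hLs hω)

/-- THE SKELETON THEOREM: the crux `ThermalStiffnessCeilingU8b10_le_1o8` (= `ObsThermalStiffnessSeqCeilingAtBeta 0 8 (7/8) 10 (1/8)`,
route «hubbard-tc-thermcert-1») from the two registered stubs. PRE-BIRTH FORM: concludes the crux BODY; after `route open` the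
import `Summits.Ventures.CertifiedManyBodySolver.Theses.TcThermcert1` is added and the statement becomes the route decl BY NAME
(`unfold` + this term). -/
theorem ThermalStiffnessCeilingU8b10_le_1o8_of :
    Summit.Ventures.CertifiedManyBodySolver.Theses.TcThermcert1.ThermalStiffnessCeilingU8b10_le_1o8 := by
  unfold Summit.Ventures.CertifiedManyBodySolver.Theses.TcThermcert1.ThermalStiffnessCeilingU8b10_le_1o8
  exact leaf_of_stubs stub_trialGeneratorHook stub_trialGeneratorCertificate_b10

/-! ## §4 Rung socket (M-K1-R1, lead RULINGS R129/R129a/R131): the SAME line at any `(β, q)` at the anchor `(8, 7/8, 0)`.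
Rungs (`β·t = 6` lever test `R1(6) := ObsThermalStiffnessSeqCeilingAtBeta 0 8 (7/8) 6 (21/100)`, by-product `R1(5) := … 5 (14/55)`) are HELPER
LEMMAS toward K1 (`--supports stmt-Ventures-26381 --as helper`), NOT registered stubs (a `β·t = 6` certificate does not imply the `β·t = 10` crux)
and NOT items (BC6). STUB 1 is already `(t′, U, n, β, q)`-generic; only the certificate statement carries `(β, q)`. -/


/-- THE RUNG SOCKET: hook + a certificate at ANY `(β, q)`, `0 < β`, at the anchor ⇒ the single-temperature leaf there (proof = `leaf_of_stubs`
with `(10, 1/8) ↦ (β, q)`; uses only the proved §1′ lemmas, which are `β`-generic). -/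
theorem leafAt_of_hook_of_certificateAt (h₁ : TrialGeneratorHook) {β : ℝ} (hβ : 0 < β) {q : ℚ}
    (h₂ : TrialGeneratorCertificateAt β q) : ObsThermalStiffnessSeqCeilingAtBeta 0 8 (7 / 8) β q := by
  obtain ⟨μ₀, hband, hsupp⟩ :=
    exists_supportingMu_mem_band (tp := 0) (U := 8) (n := 7 / 8) (β := β) (by norm_num) hβ (by norm_num) (by norm_num)
  obtain ⟨r, a, ha, hcert⟩ := h₂ μ₀ hband hsupp
  refine h₁ (tp := 0) (U := 8) (n := 7 / 8) (β := β) hβ (by norm_num) (by norm_num) r a ha ?_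
  intro ω Ls hLs hω
  exact hcert ω (isThermalRowState_of_supportingMu (by norm_num) hβ (by norm_num) (by norm_num) hsupp hLs hω)

/-- M-K1-R1 LEVER TEST socket (R129a): `β·t = 6`, leaf `21/100` (`(π/4)·(21/100) = 0.1649 < 1/6`). -/
theorem rung_b6_of (h₁ : TrialGeneratorHook) (h₂ : TrialGeneratorCertificateAt 6 (21 / 100)) :
    ObsThermalStiffnessSeqCeilingAtBeta 0 8 (7 / 8) 6 (21 / 100) :=
  leafAt_of_hook_of_certificateAt h₁ (by norm_num) h₂

/-- M-K1-R1 BY-PRODUCT socket (R129): `β·t = 5`, leaf `14/55` (`(π/4)·(14/55) = 0.19992 < 1/5`). -/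
theorem rung_b5_of (h₁ : TrialGeneratorHook) (h₂ : TrialGeneratorCertificateAt 5 (14 / 55)) :
    ObsThermalStiffnessSeqCeilingAtBeta 0 8 (7 / 8) 5 (14 / 55) :=
  leafAt_of_hook_of_certificateAt h₁ (by norm_num) h₂

/-- Consistency: the crux composition factors through the socket. -/
theorem leaf_of_stubs' (h₁ : TrialGeneratorHook) (h₂ : TrialGeneratorCertificateB10) :
    ObsThermalStiffnessSeqCeilingAtBeta 0 8 (7 / 8) 10 (1 / 8) :=
  leafAt_of_hook_of_certificateAt h₁ (by norm_num) (trialGeneratorCertificateB10_iff.mp h₂)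

end Summit.Ventures.CertifiedManyBodySolver.Cruxes.ThermalStiffnessCeilingU8b10_le_1o8.TrialGenB10

end
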